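import Mathlib
import HarnessLib
import Literature.MathematicalPhysics.QuantumLattice.HubbardGridCounterQuadratic
import Literature.MathematicalPhysics.QuantumLattice.HubbardGridSectorisedYoung
import Literature.MathematicalPhysics.QuantumLattice.GrassmannLinearSubstitution
import Summits.HubbardSuperconductivity.HubbardSuperconductivity.Theorems.KLProgrammeSectorisedLegKernelsDefs

/-!
# Route `KLProgramme` — crux K3 ENGINE (gen-3 `KLRegimeEngineV11`, stmt-HubbardSuperconductivity-19823), stub `stub_engine_scale0`:
# the scale-`n` action IS the grid image of a grid effective action, and its sectorised kernel norms are bounded by grid data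

Cell gate-hubbard-kl, seat p3 (g5); items (I5)/(I7)/(I8) of HOME/hubbard-kl-k3c2-p1/SCALE0-GRAM.md assembled.

* **`klEffectiveAction_eq_map_hubbardGridSub`** — for `β ≠ 0`, `4M ≤ N + 1`, `2M ≤ N`:
  `klEffectiveAction L M β U μ K e₀ n = map (toLin' S_N) (effAction (S_Nᵀ C^K_{>Λ_n} S_N) (V_N + 𝒩_{K,N}))` — the countertermed
  Wilsonian action at scale `Λ_n = klScale e₀ n` is the image under the grid substitution `S_N = hubbardGridSub L M β N` of the
  effective action, ON THE GRID ALGEBRA, of the grid-local quartic `hubbardGridInteraction` plus the time-local counterterm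
  `hubbardGridCounterQuadratic` with the pulled-back covariance (tree: `effAction_map`, `map_hubbardGridSub_gridInteraction`,
  `map_hubbardGridSub_gridCounterQuadratic`).  At `n = 0`, `N = 4M` this pulled-back covariance is the one of
  `EngineV8.isGramBoundedR_scaleZero_of_frameOK`, and `V_N + 𝒩_{K,N}` has the pinned kernel norms of
  `sum_norm_kernel_hubbardGridInteraction_le` / `sum_norm_kernel_hubbardGridCounterQuadratic_le` — i.e. every hypothesis of
  `GrassmannEffectiveActionBoundDB.sum_norm_kernel_effAction_le_of_gramBounded` about `V` and `C` is a tree theorem except the decay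
  constant `α` ((I6)).
* **`klAnisoLegKernelNorm_le_of_grid`** / **`klLegKernelNorm_le_of_grid`** — the (E1-v4)-type sectorised norms of the scale-`n` action,
  `klAnisoLegKernelNorm … n (m+1)` (anisotropic family, BGM constraint set) and the isotropic twin, are `≤ B^m · D · K` whenever the sector
  transfer functions `gridLegTransfer` of the family have label-summed weighted `L¹` size `≤ B` and grid size `≤ D` ((I8b), analytic, open)
  and the grid effective action has pinned degree-`(m+1)` kernel norms `≤ K` (the output of the determinant-bounded step) —
  `hubbardSectorKernelNorm_map_hubbardGridSub_le` read through the identity above.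

Bookkeeping over landed modules; nothing about the model is asserted beyond these identities/implications.
-/

noncomputable section

namespace Summit.HubbardSuperconductivity.HubbardSuperconductivity.Theorems.EngineV8

set_option linter.dupNamespace false -- summit = problem name (single-conjunct summit), D-0017

open Finset Literature.MathematicalPhysics.QuantumLattice Literature.Probability.LatticeModels GrassmannAlgebra
open Summit.HubbardSuperconductivity.HubbardSuperconductivity.Theorems.KLProgrammeLegKernels

section Model

variable {L M N : ℕ} [NeZero L]

/-- **The grid interaction of the frame `K`**: `V_N + 𝒩_{K,N}` maps to `hubbardInteractionCT L M β U K = V + 𝒩_K` under the grid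
substitution (`4M ≤ N + 1` for the quartic, `2M ≤ N` for the counterterm; `β ≠ 0`). -/
theorem map_hubbardGridSub_gridInteractionCT {β : ℝ} (hβ : β ≠ 0) (U : ℝ) (K : TrigPolyC4v) (hN : 4 * M ≤ N + 1)
    (hN2 : 2 * M ≤ N) [NeZero N] :
    ExteriorAlgebra.map (Matrix.toLin' (hubbardGridSub L M β N))
        (hubbardGridInteraction L N β U + hubbardGridCounterQuadratic L N β K) = hubbardInteractionCT L M β U K := by
  rw [map_add, map_hubbardGridSub_gridInteraction hβ U hN, map_hubbardGridSub_gridCounterQuadratic hβ K hN2, hubbardInteractionCT]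

/-- **The scale-`n` action is the grid image of a grid effective action**:
`klEffectiveAction L M β U μ K e₀ n = map (toLin' S_N) (effAction (S_Nᵀ · C^K_{>Λ_n} · S_N) (V_N + 𝒩_{K,N}))`
(`Λ_n = klScale e₀ n`; `β ≠ 0`, `4M ≤ N + 1`, `2M ≤ N`). -/
theorem klEffectiveAction_eq_map_hubbardGridSub {β : ℝ} (hβ : β ≠ 0) (U μ : ℝ) (K : TrigPolyC4v) (e₀ : ℝ) (n : ℕ)
    (hN : 4 * M ≤ N + 1) (hN2 : 2 * M ≤ N) [NeZero N] :
    klEffectiveAction L M β U μ K e₀ n =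
      ExteriorAlgebra.map (Matrix.toLin' (hubbardGridSub L M β N))
        (effAction ℂ ((hubbardGridSub L M β N).transpose * hubbardCovAboveCT L M β μ 0 K (klScale e₀ n) * hubbardGridSub L M β N)
          (hubbardGridInteraction L N β U + hubbardGridCounterQuadratic L N β K)) := by
  rw [klEffectiveAction, hubbardEffectiveActionCT_def, ← map_hubbardGridSub_gridInteractionCT hβ U K hN hN2, effAction_map,
    LinearMap.toMatrix'_toLin']

/-- The same at scale `0` with the cutoff written `e₀` (`klScale e₀ 0 = e₀`) and the grid `N = 4M` of
`EngineV8.isGramBoundedR_scaleZero_of_frameOK`. -/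
theorem klEffectiveAction_zero_eq_map_hubbardGridSub {β : ℝ} (hβ : β ≠ 0) (U μ : ℝ) (K : TrigPolyC4v) (e₀ : ℝ) [NeZero M] :
    klEffectiveAction L M β U μ K e₀ 0 =
      ExteriorAlgebra.map (Matrix.toLin' (hubbardGridSub L M β (2 * (2 * M))))
        (effAction ℂ ((hubbardGridSub L M β (2 * (2 * M))).transpose * hubbardCovAboveCT L M β μ 0 K e₀ *
            hubbardGridSub L M β (2 * (2 * M)))
          (hubbardGridInteraction L (2 * (2 * M)) β U + hubbardGridCounterQuadratic L (2 * (2 * M)) β K)) := by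
  have h := klEffectiveAction_eq_map_hubbardGridSub (L := L) (M := M) (N := 2 * (2 * M)) hβ U μ K e₀ 0 (by omega) (by omega)
  simpa [klScale] using h

/-- **The anisotropic sectorised kernel norms of the scale-`n` action from grid data** ((E1-v4)'s left side): if the sector
transfer functions of the anisotropic family satisfy `Σ_ℓ ε_x Σ_x |Φ_ℓ(x;Y)| ≤ B` and `Σ_Y |Φ_ℓ(x;Y)| ≤ D`, and the grid effective action
`effAction (S_Nᵀ C^K_{>Λ_n} S_N) (V_N + 𝒩_{K,N})` has pinned degree-`(m+1)` kernel norms `≤ K`, then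
`klAnisoLegKernelNorm L M β U μ K e₀ n (m+1) ≤ B^m · D · K`. -/
theorem klAnisoLegKernelNorm_le_of_grid {β : ℝ} (hβ : 0 < β) (U μ : ℝ) (K : TrigPolyC4v) (e₀ : ℝ) (n : ℕ)
    (hN : 4 * M ≤ N + 1) (hN2 : 2 * M ≤ N) [NeZero N] {m : ℕ} {B D Kb : ℝ} (hB0 : 0 ≤ B) (hD0 : 0 ≤ D) (hK0 : 0 ≤ Kb)
    (hB : ∀ Y : GridLeg (GridPoint L N), ∑ ℓ : SectorLeg (sectorCount n), imagTimeWeight β M *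
      ∑ x : SpaceTimeIdx L M, ‖gridLegTransfer L M N β (klAnisoFamily L M β μ K e₀ n) ℓ x Y‖ ≤ B)
    (hD : ∀ (ℓ : SectorLeg (sectorCount n)) (x : SpaceTimeIdx L M),
      ∑ Y : GridLeg (GridPoint L N), ‖gridLegTransfer L M N β (klAnisoFamily L M β μ K e₀ n) ℓ x Y‖ ≤ D)
    (hK : ∀ (p : Fin (m + 1)) (w : GridLeg (GridPoint L N)),
      ∑ Y ∈ univ.filter (fun Y : Fin (m + 1) → GridLeg (GridPoint L N) => Y p = w),
        ‖kernel ℂ (effAction ℂ ((hubbardGridSub L M β N).transpose * hubbardCovAboveCT L M β μ 0 K (klScale e₀ n) *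
            hubbardGridSub L M β N) (hubbardGridInteraction L N β U + hubbardGridCounterQuadratic L N β K)) (m + 1) Y‖ ≤ Kb) :
    klAnisoLegKernelNorm L M β U μ K e₀ n (m + 1) ≤ B ^ m * D * Kb := by
  rw [klAnisoLegKernelNorm, klEffectiveAction_eq_map_hubbardGridSub hβ.ne' U μ K e₀ n hN hN2]
  exact hubbardSectorKernelNorm_map_hubbardGridSub_le hβ.le _ _ _ hB0 hD0 hK0 hB hD hK

/-- **The isotropic sectorised kernel norms of the scale-`n` action from grid data** (the `klLegKernelNorm` twin, (B2)/(E5)'s objects). -/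
theorem klLegKernelNorm_le_of_grid {β : ℝ} (hβ : 0 < β) (U μ : ℝ) (K : TrigPolyC4v) (e₀ : ℝ) (n : ℕ)
    (hN : 4 * M ≤ N + 1) (hN2 : 2 * M ≤ N) [NeZero N] {m : ℕ} {B D Kb : ℝ} (hB0 : 0 ≤ B) (hD0 : 0 ≤ D) (hK0 : 0 ≤ Kb)
    (hB : ∀ Y : GridLeg (GridPoint L N), ∑ ℓ : SectorLeg (sectorCount (2 * n)), imagTimeWeight β M *
      ∑ x : SpaceTimeIdx L M, ‖gridLegTransfer L M N β (klIsoFamily L M β μ K e₀ n) ℓ x Y‖ ≤ B)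
    (hD : ∀ (ℓ : SectorLeg (sectorCount (2 * n))) (x : SpaceTimeIdx L M),
      ∑ Y : GridLeg (GridPoint L N), ‖gridLegTransfer L M N β (klIsoFamily L M β μ K e₀ n) ℓ x Y‖ ≤ D)
    (hK : ∀ (p : Fin (m + 1)) (w : GridLeg (GridPoint L N)),
      ∑ Y ∈ univ.filter (fun Y : Fin (m + 1) → GridLeg (GridPoint L N) => Y p = w),
        ‖kernel ℂ (effAction ℂ ((hubbardGridSub L M β N).transpose * hubbardCovAboveCT L M β μ 0 K (klScale e₀ n) *
            hubbardGridSub L M β N) (hubbardGridInteraction L N β U + hubbardGridCounterQuadratic L N β K)) (m + 1) Y‖ ≤ Kb) :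
    klLegKernelNorm L M β U μ K e₀ n (m + 1) ≤ B ^ m * D * Kb := by
  rw [klLegKernelNorm, klEffectiveAction_eq_map_hubbardGridSub hβ.ne' U μ K e₀ n hN hN2]
  exact hubbardSectorKernelNorm_map_hubbardGridSub_le hβ.le _ _ _ hB0 hD0 hK0 hB hD hK

end Model

end Summit.HubbardSuperconductivity.HubbardSuperconductivity.Theorems.EngineV8

end
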